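import Mathlib.RingTheory.LocalRing.Module
import Mathlib.RingTheory.Localization.BaseChange
import Mathlib.RingTheory.Localization.AtPrime.Basic
import Mathlib.RingTheory.Localization.Integer
import Mathlib.LinearAlgebra.TensorProduct.RightExactness
import Mathlib.LinearAlgebra.Dimension.Constructions
import Mathlib.LinearAlgebra.FreeModule.StrongRankCondition
import HarnessLib

/-!
# Choosing `N - q` equations by their linear parts along the centre (Nakayama)

Topic: `Literature/AlgebraicGeometry/Smoothening` (Bosch–Lütkebohmert–Raynaud, *Néron Models*,
§3.3, Lemma 4 and the proof of Prop. 5: over the open `U_k` of the centre where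
`Ω¹_{X/R}|_{U_k}` is locally free of rank `q`, the conormal images of the equations of `X` are
generated, locally, by `N - q` of them). Module-theoretic form: let `C` be a ring (the
coordinate ring of the centre), `𝔓` a prime, `W` a finite free `C`-module (the restriction of
`Ω¹` of the ambient space to the centre) and `γ : ι → W` a family (the `1 ⊗ df`, `f` an equation
of `X`) spanning `N ⊆ W`. If `(W/N)_𝔓 = C_𝔓 ⊗_C (W/N)` is free of rank `q` over the local ring
`C_𝔓`, then there are `p` members `γ (F 1), …, γ (F p)` of the family, `p + q = rank W`, which
generate all the `γ i` up to denominators prime to `𝔓`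
(`exists_generators_of_free_localization`): `N_𝔓` is a direct summand of the free module `W_𝔓`,
hence free of rank `rank W - q`, and by Nakayama's lemma a basis of `N_𝔓 ⊗ κ(𝔓)` chosen among
the `γ i` generates `N_𝔓`.

This is the hypothesis `hgenW` of `CentreLinearPart.exists_mul_mem_span_sup_vanishingLinearPart`.
[folklore] commutative algebra (Mathlib: `IsLocalRing.span_eq_top_of_tmul_eq_basis`,
`Module.free_of_flat_of_isLocalRing`, `IsLocalizedModule`); no named facts (D-0026).

## References

* S. Bosch, W. Lütkebohmert, M. Raynaud, *Néron Models*, Springer 1990, §3.3, Lemma 4,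
  Prop. 5. [BLRNeronModels1990] (Not held; numbers only.)
-/

noncomputable section

open scoped TensorProduct
open Module Submodule IsLocalRing

namespace Literature.AlgebraicGeometry.Smoothening

universe u v

section General

variable {A : Type u} [CommRing A] {M : Type v} [AddCommGroup M] [Module A M]

/-- The kernel of the base change of a quotient map is spanned by the `1 ⊗ n`. [folklore] -/
theorem ker_baseChange_mkQ (L : Type u) [CommRing L] [Algebra A L] (N : Submodule A M) :
    LinearMap.ker ((N.mkQ).baseChange L) = span L (Set.range fun n : N => (1 : L) ⊗ₜ[A] (n : M)) := by
  have hex := lTensor_exact L (LinearMap.exact_subtype_mkQ N) (mkQ_surjective N)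
  rw [LinearMap.exact_iff] at hex
  have hker : ∀ x, x ∈ LinearMap.ker ((N.mkQ).baseChange L) ↔ x ∈ LinearMap.range ((N.subtype).lTensor L) := by
    intro x
    rw [← hex, LinearMap.mem_ker, LinearMap.mem_ker,
      show (N.mkQ).baseChange L x = (N.mkQ).lTensor L x from
        congrFun (LinearMap.baseChange_eq_ltensor (N.mkQ) (A := L)) x]
  apply le_antisymm
  · intro x hx
    obtain ⟨y, rfl⟩ := (hker x).mp hx
    induction y using TensorProduct.induction_on with
    | zero => rw [map_zero]; exact zero_mem _
    | add a b ha hb =>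
      rw [map_add]
      exact add_mem (ha ((hker _).mpr ⟨a, rfl⟩)) (hb ((hker _).mpr ⟨b, rfl⟩))
    | tmul l n =>
      rw [LinearMap.lTensor_tmul]
      have : l ⊗ₜ[A] (N.subtype n) = l • ((1 : L) ⊗ₜ[A] (n : M)) := by
        rw [TensorProduct.smul_tmul', smul_eq_mul, mul_one]; rfl
      rw [this]
      exact smul_mem _ _ (subset_span ⟨n, rfl⟩)
  · rw [span_le]
    rintro _ ⟨n, rfl⟩
    rw [SetLike.mem_coe, LinearMap.mem_ker, LinearMap.baseChange_tmul, mkQ_apply,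
      (Quotient.mk_eq_zero N).mpr n.2, TensorProduct.tmul_zero]

end General

section Main

variable {C : Type u} [CommRing C] (𝔓 : Ideal C) [𝔓.IsPrime]
  (L : Type u) [CommRing L] [IsLocalRing L] [Algebra C L] [IsLocalization.AtPrime L 𝔓]
  {W : Type u} [AddCommGroup W] [Module C W] [Module.Free C W] [Module.Finite C W]
  {ι : Type u} (γ : ι → W)

/-- **Choosing `rank W - q` generators by Nakayama.** Let `W` be a finite free module over `C`,
`γ : ι → W` a family spanning `N`, `𝔓` a prime and `L = C_𝔓` (any localization of `C` at `𝔓`)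
such that `L ⊗_C (W/N)` is free over `L` of rank `q`. Then some `p` members of the family,
`p + q = rank W`, generate every `γ i` up to a denominator prime to `𝔓`:
`t γ i = Σ c_k γ (F k)` with `t ∉ 𝔓`. [folklore] -/
theorem exists_generators_of_free_localization
    [Module.Free L (L ⊗[C] (W ⧸ span C (Set.range γ)))] :
    ∃ (p : ℕ) (F : Fin p → ι),
      p + Module.finrank L (L ⊗[C] (W ⧸ span C (Set.range γ))) = Module.finrank C W ∧
      ∀ i : ι, ∃ t : C, t ∉ 𝔓 ∧ ∃ c : Fin p → C, t • γ i = ∑ k, c k • γ (F k) := by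
  classical
  -- `W_L → L ⊗ (W/N)` and its kernel `N_L`
  obtain ⟨g, hg⟩ : ∃ g : L ⊗[C] W →ₗ[L] L ⊗[C] (W ⧸ span C (Set.range γ)),
      g = ((span C (Set.range γ)).mkQ).baseChange L := ⟨_, rfl⟩
  have hgsurj : Function.Surjective g := by
    rw [hg, LinearMap.baseChange_eq_ltensor]
    exact LinearMap.lTensor_surjective L (mkQ_surjective _)
  obtain ⟨NL, hNL⟩ : ∃ NL : Submodule L (L ⊗[C] W), NL = LinearMap.ker g := ⟨_, rfl⟩
  have hNLmem : ∀ y : L ⊗[C] W, y ∈ NL ↔ g y = 0 := fun y => by rw [hNL, LinearMap.mem_ker]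
  have hNLspan : NL = span L (Set.range fun i => (1 : L) ⊗ₜ[C] γ i) := by
    rw [hNL, hg, ker_baseChange_mkQ]
    apply le_antisymm
    · rw [span_le]
      rintro _ ⟨⟨n, hn⟩, rfl⟩
      simp only [SetLike.mem_coe]
      induction hn using span_induction with
      | mem _ h => obtain ⟨i, rfl⟩ := h; exact subset_span ⟨i, rfl⟩
      | zero => rw [TensorProduct.tmul_zero]; exact zero_mem _
      | add x y _ _ hx hy => rw [TensorProduct.tmul_add]; exact add_mem hx hy
      | smul a x _ hx =>
        rw [TensorProduct.tmul_smul, ← algebraMap_smul L a]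
        exact smul_mem _ _ hx
    · rw [span_le]
      rintro _ ⟨i, rfl⟩
      exact subset_span ⟨⟨γ i, subset_span ⟨i, rfl⟩⟩, rfl⟩
  -- a section `s` of `g` (the target is free, hence projective)
  haveI : Module.Projective L (L ⊗[C] (W ⧸ span C (Set.range γ))) := Module.Projective.of_free
  obtain ⟨s, hs⟩ := Module.projective_lifting_property g (LinearMap.id) hgsurj
  have hgs : ∀ q, g (s q) = q := fun q => LinearMap.congr_fun hs q
  -- the retraction `r x = x - s (g x)` onto `N_L` and the splitting `W_L ≃ N_L × Q`
  have hr_mem : ∀ x, x - s (g x) ∈ NL := fun x => by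
    rw [hNLmem, map_sub, hgs, sub_self]
  let r : L ⊗[C] W →ₗ[L] NL := LinearMap.codRestrict NL (LinearMap.id - s ∘ₗ g) fun x => hr_mem x
  have hr : ∀ x, (r x : L ⊗[C] W) = x - s (g x) := fun x => rfl
  have hgn : ∀ n : NL, g (n : L ⊗[C] W) = 0 := fun n => (hNLmem _).mp n.2
  have hrn : ∀ n : NL, r n = n := fun n => Subtype.ext (by rw [hr, hgn, map_zero, sub_zero])
  have hri : r ∘ₗ NL.subtype = LinearMap.id := by
    ext n
    exact congrArg Subtype.val (hrn n)
  have hbij : Function.Bijective (r.prod g) := by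
    constructor
    · intro x y hxy
      have h1 : r x = r y := congrArg Prod.fst hxy
      have h2 : g x = g y := congrArg Prod.snd hxy
      have h1' := congrArg Subtype.val h1
      rw [hr, hr, h2] at h1'
      exact sub_left_injective h1'
    · rintro ⟨n, q⟩
      refine ⟨(n : L ⊗[C] W) + s q, Prod.ext ?_ ?_⟩
      · change r ((n : L ⊗[C] W) + s q) = n
        apply Subtype.ext
        rw [hr, map_add, hgn, hgs, zero_add, add_sub_cancel_right]
      · change g ((n : L ⊗[C] W) + s q) = q
        rw [map_add, hgn, hgs, zero_add]
  let e := LinearEquiv.ofBijective (r.prod g) hbij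
  -- `N_L` is finite free of rank `rank W - q`
  haveI : Module.Finite L NL := Module.Finite.of_surjective r fun n => ⟨n, hrn n⟩
  haveI : Module.Projective L NL := Module.Projective.of_split NL.subtype r hri
  haveI : Module.Flat L NL := Module.Flat.of_projective
  haveI : Module.Free L NL := Module.free_of_flat_of_isLocalRing (P := NL)
  haveI : Nontrivial C := ⟨⟨0, 1, fun h01 =>
    (Ideal.ne_top_iff_one 𝔓).mp (Ideal.IsPrime.ne_top inferInstance) (h01 ▸ 𝔓.zero_mem)⟩⟩
  have hrank : Module.finrank L NL + Module.finrank L (L ⊗[C] (W ⧸ span C (Set.range γ))) =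
      Module.finrank C W := by
    rw [← Module.finrank_baseChange (R := L) (M' := W), e.finrank_eq, Module.finrank_prod]
  -- Nakayama: choose a basis of `κ ⊗ N_L` among the `1 ⊗ γ i`
  let uN : ι → NL := fun i => ⟨(1 : L) ⊗ₜ[C] γ i, by rw [hNLspan]; exact subset_span ⟨i, rfl⟩⟩
  have huNspan : span L (Set.range uN) = ⊤ := by
    apply map_injective_of_injective NL.injective_subtype
    rw [Submodule.map_span, ← Set.range_comp, Submodule.map_top, range_subtype]
    exact hNLspan.symm
  let w : ι → ResidueField L ⊗[L] NL := fun i => (1 : ResidueField L) ⊗ₜ[L] uN i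
  have hwspan : span (ResidueField L) (Set.range w) = ⊤ := by
    have h := congrArg (fun P : Submodule L NL => P.baseChange (ResidueField L)) huNspan
    simp only [baseChange_span, baseChange_top, ← Set.range_comp] at h
    exact h
  obtain ⟨b, hb, hbspan, hblin⟩ := exists_linearIndependent (ResidueField L) (Set.range w)
  have hbspan' : span (ResidueField L) b = ⊤ := by rw [hbspan, hwspan]
  let basis : Basis b (ResidueField L) (ResidueField L ⊗[L] NL) :=
    Basis.mk hblin (by rw [Subtype.range_coe_subtype, Set.setOf_mem_eq, hbspan'])
  haveI : Fintype b := FiniteDimensional.fintypeBasisIndex basis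
  -- the selected indices
  have hsel : ∀ x : b, ∃ i : ι, w i = x := fun x => by
    obtain ⟨i, hi⟩ := hb x.2; exact ⟨i, hi⟩
  choose sel hsel using hsel
  have hgen : span L (Set.range (uN ∘ sel)) = ⊤ :=
    IsLocalRing.span_eq_top_of_tmul_eq_basis (uN ∘ sel) basis fun x => by
      rw [Basis.mk_apply, Function.comp_apply, ← hsel x]
  -- cardinality
  have hcard : Fintype.card b = Module.finrank L NL := by
    rw [← Module.finrank_baseChange (R := ResidueField L) (M' := NL),
      Module.finrank_eq_card_basis basis]
  -- reindex by `Fin p`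
  let ε : Fin (Fintype.card b) ≃ b := (Fintype.equivFin b).symm
  refine ⟨Fintype.card b, sel ∘ ε, by rw [hcard, hrank], fun i => ?_⟩
  -- `1 ⊗ γ i ∈ span_L (1 ⊗ γ (F k))`
  have hmem : uN i ∈ span L (Set.range (uN ∘ sel ∘ ε)) := by
    have : Set.range (uN ∘ sel ∘ ε) = Set.range (uN ∘ sel) := by
      rw [show uN ∘ sel ∘ ε = (uN ∘ sel) ∘ ε from rfl, Set.range_comp (uN ∘ sel) ε,
        ε.range_eq_univ, Set.image_univ]
    rw [this, hgen]; trivial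
  obtain ⟨ℓ, hℓ⟩ := (Submodule.mem_span_range_iff_exists_fun L).mp hmem
  have hℓ' : (1 : L) ⊗ₜ[C] γ i = ∑ k, ℓ k • ((1 : L) ⊗ₜ[C] γ (sel (ε k))) := by
    have := congrArg Subtype.val hℓ
    simpa [uN] using this.symm
  -- clear the denominators of the `ℓ k`
  obtain ⟨⟨d, hd⟩, hdint⟩ := IsLocalization.exist_integer_multiples_of_finite 𝔓.primeCompl ℓ
  choose a ha using hdint
  -- `d (1 ⊗ γ i) = Σ a_k (1 ⊗ γ (F k))` in `W_L`, then pull back to `W`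
  have hW : (TensorProduct.mk C L W 1) (d • γ i) =
      (TensorProduct.mk C L W 1) (∑ k, a k • γ (sel (ε k))) := by
    rw [TensorProduct.mk_apply, TensorProduct.mk_apply, TensorProduct.tmul_smul,
      ← algebraMap_smul L d, hℓ', Finset.smul_sum, TensorProduct.tmul_sum]
    refine Finset.sum_congr rfl fun k _ => ?_
    rw [TensorProduct.tmul_smul, ← algebraMap_smul L (a k), smul_smul, ha k, Algebra.smul_def]
  obtain ⟨⟨t, ht⟩, htW⟩ := (IsLocalizedModule.eq_iff_exists 𝔓.primeCompl (TensorProduct.mk C L W 1)).mp hW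
  refine ⟨t * d, 𝔓.primeCompl.mul_mem ht hd, fun k => t * a k, ?_⟩
  simp only [Submonoid.smul_def, Finset.smul_sum, smul_smul] at htW
  show (t * d) • γ i = ∑ k, (t * a k) • γ (sel (ε k))
  exact htW

end Main

end Literature.AlgebraicGeometry.Smoothening
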